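import Literature.Probability.RandomPlanarGeometry.HexSAWBrickWallStripFugacityWidthOneContactMeanCorrection
import HarnessLib

/-!
# The top wall by reflection: mean to second order and variance of the number of TOP contacts, and the two-wall sum rule

Topic `Literature/Probability/RandomPlanarGeometry` (continues `HexSAWBrickWallStripFugacityWidthOneContactVariance.lean` (`Var_{N,y,z}(bc)/N → ∂b/∂log y`),
`…ContactMeanCorrection.lean` (`⟨bc⟩_{2M+c} − (2M+c)b → γ_c`), `…ContactDensity.lean` (`meanContacts`, `tendsto_meanContacts_div`,
`contactB_add_contactB_swap`) and `…FugacitySymmetric.lean` (the reflection `flipPair` of the strip exchanging the two walls: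
`bottomVisits₀_flipPair`, `topVisits₀_flipPair`, `stripZ₂_symm`)).
The previous files treat the BOTTOM wall (fugacity `y`).  THIS FILE transfers every statement to the TOP wall (fugacity `z`) by the reflection —
the law of `tc` under `P_{N,y,z}` is the law of `bc` under `P_{N,z,y}` — and records the first-order SUM RULE for the two walls:

* §1 `meanTopContacts`, `sqTopContacts`, `varTopContacts` (defs); ★ `sum_wgt_mul_topVisits` (`Σ_q y^{bc}z^{tc} f(tc) = Σ_q z^{bc}y^{tc} f(bc)`),
  `meanTopContacts_eq`, `sqTopContacts_eq`, `varTopContacts_eq` (`= meanContacts z y N`, … — exchange of the fugacities).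
* §2 ★★ `tendsto_meanTopContacts_div` (`⟨tc⟩_{N,y,z}/N → b(z,y)`), ★★★ `tendsto_mean_twoWall_div`
  (`(⟨bc⟩ + ⟨tc⟩)_{N,y,z}/N → b(y,z) + b(z,y) = v₂(y,z)/2`: on average exactly half of the two-wall speed `v₂ ∈ (2/3, 1)` of the steps are
  surface contacts), ★★ `tendsto_meanTopContacts_sub_linear` (`⟨tc⟩_{2M+c} − (2M+c)b(z,y) → γ_c(z,y)`, parity-dependent O(1) term).
* §3 ★★★ `tendsto_varTopContacts_div` (`Var_{N,y,z}(tc)/N → d/dB b(e^B, y)|_{B = log z} > 0`), ★★ `tendsto_varTopContacts_div_explicit`,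
  ★★ `tendsto_varTopContacts_div_uniform` (uniform strip: the same constant `(21μ²+95μ−14)/1058 ≈ 0.1405` as for the bottom wall).
(The Gaussian mgf of `tc` follows in one line from `…ContactGaussianMGF.tendsto_contactMGF_gaussian hz hy` and `stripZ₂_symm`; it is left to the
file that imports both.)

## Sources
N. R. Beaton, M. Bousquet-Mélou, J. de Gier, H. Duminil-Copin, A. J. Guttmann, CMP 326 (2014), arXiv:1109.0358v5, §3.2 Proposition 6 (p. 10:
"by the symmetry of bridges, μ_T(y,z) = μ_T(z,y)" — the reflection); A. Dembo, O. Zeitouni (2010) §2.3 (lane statements of the mean/variance laws);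
N. Madras, G. Slade (1993) §1.1.  Nothing is quoted AS PRINTED; statements and constants are this lineage's.
-/

noncomputable section

open Filter Topology Finset Set Literature.Analysis
open Literature.Probability.LatticeModels Literature.Probability.Percolation

namespace Literature.Probability.RandomPlanarGeometry.SAW.HexBW

namespace WidthOneYZ

variable {y z : ℝ}

/-! ## §1 Top-contact moments and the reflection -/

/-- **The mean number of TOP contacts under `P_{N,y,z}`**: `⟨tc⟩_{N,y,z}`. [cite: BeatonBousquetMelouDeGierDuminilCopinGuttmann2014, §3.2 (arXiv v5 p. 10: the weights y^{bc} z^{tc})] -/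
def meanTopContacts (y z : ℝ) (N : ℕ) : ℝ :=
  (∑ q ∈ stripPairs 1 N, wgt y z N q * (topVisits₀ 1 q.1 q.2 N : ℝ)) / stripZ₂ 1 N y z

/-- **Second moment of the top contacts under `P_{N,y,z}`**: `⟨tc²⟩_{N,y,z}`. [cite: BeatonBousquetMelouDeGierDuminilCopinGuttmann2014, §3.2 (arXiv v5 p. 10)] -/
def sqTopContacts (y z : ℝ) (N : ℕ) : ℝ :=
  (∑ q ∈ stripPairs 1 N, wgt y z N q * (topVisits₀ 1 q.1 q.2 N : ℝ) ^ 2) / stripZ₂ 1 N y z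

/-- ★ **The variance of the number of top contacts under `P_{N,y,z}`**: `Var_{N,y,z}(tc) = ⟨tc²⟩ − ⟨tc⟩²`.
[cite: BeatonBousquetMelouDeGierDuminilCopinGuttmann2014, §3.2 (arXiv v5 p. 10); DemboZeitouni2010, §2.3 (lane statement)] -/
def varTopContacts (y z : ℝ) (N : ℕ) : ℝ := sqTopContacts y z N - meanTopContacts y z N ^ 2

open Classical in
/-- ★ **The reflection transfers top-contact functionals at `(y,z)` to bottom-contact functionals at `(z,y)`**:
`Σ_q y^{bc(q)} z^{tc(q)} f(tc(q)) = Σ_q z^{bc(q)} y^{tc(q)} f(bc(q))` for every `f` (tree: `flipPair`, `bottomVisits₀_flipPair`, `topVisits₀_flipPair`).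
[cite: BeatonBousquetMelouDeGierDuminilCopinGuttmann2014, Proposition 6 (arXiv v5 p. 10: "by the symmetry of bridges, μ_T(y,z) = μ_T(z,y)")] -/
theorem sum_wgt_mul_topVisits (y z : ℝ) (N : ℕ) (f : ℕ → ℝ) :
    ∑ q ∈ stripPairs 1 N, wgt y z N q * f (topVisits₀ 1 q.1 q.2 N) =
      ∑ q ∈ stripPairs 1 N, wgt z y N q * f (bottomVisits₀ q.1 q.2 N) := by
  have himg : (stripPairs 1 N).image (flipPair 1) = stripPairs 1 N := by
    refine Finset.eq_of_subset_of_card_le (fun q hq => ?_) ?_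
    · obtain ⟨p, hp, rfl⟩ := Finset.mem_image.1 hq
      exact flipPair_mem hp
    · rw [Finset.card_image_of_injOn (flipPair_injOn 1 N)]
  calc ∑ q ∈ stripPairs 1 N, wgt y z N q * f (topVisits₀ 1 q.1 q.2 N)
      = ∑ q ∈ (stripPairs 1 N).image (flipPair 1), wgt y z N q * f (topVisits₀ 1 q.1 q.2 N) := by rw [himg]
    _ = ∑ p ∈ stripPairs 1 N, wgt y z N (flipPair 1 p) * f (topVisits₀ 1 (flipPair 1 p).1 (flipPair 1 p).2 N) :=
        Finset.sum_image (flipPair_injOn 1 N)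
    _ = ∑ p ∈ stripPairs 1 N, wgt z y N p * f (bottomVisits₀ p.1 p.2 N) := by
        refine Finset.sum_congr rfl fun p _ => ?_
        simp only [wgt, topVisits₀_flipPair, bottomVisits₀_flipPair, mul_comm]

/-- `⟨tc⟩_{N,y,z} = ⟨bc⟩_{N,z,y}`. [cite: BeatonBousquetMelouDeGierDuminilCopinGuttmann2014, Proposition 6 (arXiv v5 p. 10: symmetry)] -/
theorem meanTopContacts_eq (y z : ℝ) (N : ℕ) : meanTopContacts y z N = meanContacts z y N := by
  unfold meanTopContacts meanContacts
  rw [sum_wgt_mul_topVisits y z N (fun k => (k : ℝ)), stripZ₂_symm]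

/-- `⟨tc²⟩_{N,y,z} = ⟨bc²⟩_{N,z,y}`. [cite: BeatonBousquetMelouDeGierDuminilCopinGuttmann2014, Proposition 6 (arXiv v5 p. 10: symmetry)] -/
theorem sqTopContacts_eq (y z : ℝ) (N : ℕ) : sqTopContacts y z N = sqContacts z y N := by
  unfold sqTopContacts sqContacts
  rw [sum_wgt_mul_topVisits y z N (fun k => (k : ℝ) ^ 2), stripZ₂_symm]

/-- `Var_{N,y,z}(tc) = Var_{N,z,y}(bc)`. [cite: BeatonBousquetMelouDeGierDuminilCopinGuttmann2014, Proposition 6 (arXiv v5 p. 10: symmetry)] -/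
theorem varTopContacts_eq (y z : ℝ) (N : ℕ) : varTopContacts y z N = varContacts z y N := by
  rw [varTopContacts, varContacts, sqTopContacts_eq, meanTopContacts_eq]

/-! ## §2 The mean number of top contacts: density, the two-wall sum rule, the second-order term -/

/-- ★★ **THE TOP CONTACT DENSITY IN MEAN**: `⟨tc⟩_{N,y,z}/N → b(z,y)`. [cite: BeatonBousquetMelouDeGierDuminilCopinGuttmann2014, §3.2 Proposition 6 (arXiv v5 p. 10); MadrasSlade1993, §8.5 pp. 278–279] -/
theorem tendsto_meanTopContacts_div (hy : 0 < y) (hz : 0 < z) :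
    Tendsto (fun N : ℕ => meanTopContacts y z N / N) atTop (𝓝 (contactB z y)) := by
  simp_rw [meanTopContacts_eq]
  exact tendsto_meanContacts_div hz hy

/-- ★★★ **THE TWO-WALL SUM RULE**: `(⟨bc⟩ + ⟨tc⟩)_{N,y,z}/N → b(y,z) + b(z,y) = v₂(y,z)/2` — on average exactly HALF of the two-wall speed
`v₂(y,z) ∈ (2/3, 1)` (the mean fraction of vertical steps, `…WidthOneSpeed`) of the steps of a long strip walk are surface contacts, split
between the walls as `b(y,z) : b(z,y)` (tree: `contactB_add_contactB_swap`).
[cite: BeatonBousquetMelouDeGierDuminilCopinGuttmann2014, §3.2 Proposition 6 (arXiv v5 p. 10); MadrasSlade1993, §1.1] -/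
theorem tendsto_mean_twoWall_div (hy : 0 < y) (hz : 0 < z) :
    Tendsto (fun N : ℕ => (meanContacts y z N + meanTopContacts y z N) / N) atTop (𝓝 (twoWallSpeed y z / 2)) := by
  rw [← contactB_add_contactB_swap hy hz]
  have h := (tendsto_meanContacts_div hy hz).add (tendsto_meanTopContacts_div hy hz)
  exact h.congr fun N => by ring

/-- ★★ **THE MEAN NUMBER OF TOP CONTACTS TO SECOND ORDER**: along each parity class,
`⟨tc⟩_{2M+c,y,z} − (2M+c)·b(z,y) → γ_c(z,y) = d/dB log A_c(e^B, y)|_{B = log z}` (the bottom-wall statement with the fugacities exchanged).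
[cite: DemboZeitouni2010, §2.3 (lane statement); BeatonBousquetMelouDeGierDuminilCopinGuttmann2014, §3.2 Proposition 6 (arXiv v5 p. 10)] -/
theorem tendsto_meanTopContacts_sub_linear (hy : 0 < y) (hz : 0 < z) {c : ℕ} (hc : c < 2) :
    Tendsto (fun M : ℕ => meanTopContacts y z (2 * M + c) - (2 * (M : ℝ) + c) * contactB z y) atTop
      (𝓝 (deriv (fun B => Real.log (parityAmplitude c (Real.exp B) y)) (Real.log z))) := by
  simp_rw [meanTopContacts_eq]
  exact tendsto_meanContacts_sub_linear hz hy hc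

/-! ## §3 The variance of the number of top contacts -/

/-- ★★★ **THE VARIANCE OF THE TOP CONTACT NUMBER**: for all `y, z > 0`, `Var_{N,y,z}(tc)/N → d/dB b(e^B, y)|_{B = log z}`, and the limit is
positive (the `z`-susceptibility of the top contact density; inverse-Hessian form in `tendsto_varContacts_div_explicit` with the fugacities exchanged).
[cite: DemboZeitouni2010, §2.3 (lane statement); BeatonBousquetMelouDeGierDuminilCopinGuttmann2014, §3.2 Proposition 6 (arXiv v5 p. 10); MadrasSlade1993, §8.5 pp. 278–279] -/
theorem tendsto_varTopContacts_div (hy : 0 < y) (hz : 0 < z) :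
    Tendsto (fun N : ℕ => varTopContacts y z N / N) atTop (𝓝 (deriv (fun B => contactB (Real.exp B) y) (Real.log z))) ∧
      0 < deriv (fun B => contactB (Real.exp B) y) (Real.log z) := by
  refine ⟨?_, ?_⟩
  · simp_rw [varTopContacts_eq]
    exact tendsto_varContacts_div hz hy
  · have h := hasDerivAt_contactB_log (Real.log z) (Real.log y)
    simp only [Real.exp_log hy, Real.exp_log hz] at h
    obtain ⟨-, -, dA, -, -, hpos, -⟩ := h
    rw [dA.deriv]
    exact hpos

/-- ★★ **Explicit form** of the top-wall variance rate: with `b = b(z,y)` (top density), `b' = b(y,z)` and the entries `m_{ij}` of the Hessian of the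
contact entropy at the typical pair (fugacities exchanged), `Var_{N,y,z}(tc)/N → m₂₂/(m₁₁m₂₂ − m₁₂²) > 0`.
[cite: DemboZeitouni2010, §2.3 (lane statement); BeatonBousquetMelouDeGierDuminilCopinGuttmann2014, §3.2 Proposition 6 (arXiv v5 p. 10)] -/
theorem tendsto_varTopContacts_div_explicit (hy : 0 < y) (hz : 0 < z) :
    let b := contactB z y
    let b' := contactB y z
    let m₁₁ := 4 / (1 - 2 * b - 2 * b') + 8 / (4 * b + 2 * b' - 1) + 2 / (2 * b + 4 * b' - 1) - 1 / b
    let m₁₂ := 4 / (1 - 2 * b - 2 * b') + 4 / (4 * b + 2 * b' - 1) + 4 / (2 * b + 4 * b' - 1)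
    let m₂₂ := 4 / (1 - 2 * b - 2 * b') + 2 / (4 * b + 2 * b' - 1) + 8 / (2 * b + 4 * b' - 1) - 1 / b'
    Tendsto (fun N : ℕ => varTopContacts y z N / N) atTop (𝓝 (m₂₂ / (m₁₁ * m₂₂ - m₁₂ ^ 2))) ∧
      0 < m₂₂ / (m₁₁ * m₂₂ - m₁₂ ^ 2) := by
  intro b b' m₁₁ m₁₂ m₂₂
  simp_rw [varTopContacts_eq]
  exact tendsto_varContacts_div_explicit hz hy

/-- ★★ **THE UNIFORM STRIP, TOP WALL**: for the plain SAW on the width-one strip (`y = z = 1`), `Var_N(tc)/N → (21μ² + 95μ − 14)/1058 ∈ (0.1405, 0.1406)`,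
the same constant as for the bottom wall (reflection symmetry). [cite: DemboZeitouni2010, §2.3 (lane statement); BeatonBousquetMelouDeGierDuminilCopinGuttmann2014, §3.2 Proposition 6 (arXiv v5 p. 10)] -/
theorem tendsto_varTopContacts_div_uniform :
    Tendsto (fun N : ℕ => varTopContacts 1 1 N / N) atTop
      (𝓝 ((21 * stripConnectiveConstant 1 ^ 2 + 95 * stripConnectiveConstant 1 - 14) / 1058)) := by
  simp_rw [varTopContacts_eq]
  exact tendsto_varContacts_div_uniform.1

end WidthOneYZ

end Literature.Probability.RandomPlanarGeometry.SAW.HexBW
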